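import Literature.NumberTheory.GaloisRepresentations.IdeleClassBarSModAlphaOneSurjective
import Literature.NumberTheory.GaloisRepresentations.IdeleClassBarSInvariantSubgroup
import Literature.Algebra.Homology.DiscreteRepModPairingCofinal
import HarnessLib

/-!
# Milne's hypothesis (b) for the `S`-idèle class formation: `α¹(U, ℤ/m)` is bijective at every open normal `U ≤ G_S`
# (Milne ADT I Thm. 1.8 (b) for `(G_S, C̄_S, inv_S)`; Harari Prop. 15.42 (a), Thm. 17.2; Tate C–F VII §11.3, §5.1)

Topic `NumberTheory/GaloisRepresentations`; namespace `Literature.NumberTheory.GaloisRepresentations.IdeleClassBar`.  Assembly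
file (theorems only; no definition, no named fact, no instance, no notation, no `sorry`) of brick D2-(b) of the background lane
«PT-Ш-S-TC» of crux `GoodLatticeBDPValue` (stmt-BirchSwinnertonDyer-19032), cell `bsd-eis`: the field
`adjointBijective_one_zmod_pow` of bsd-line-x1-p1-w7's `DiscreteRep.TateDualityHypothesesAt p (classBarSD K S) (invS S)` — and
in fact `α¹(U, ℤ/m)` bijective for EVERY `m ≥ 1` — from

* door-c4 g16's criterion `DiscreteRep.adjointBijective_triv_zmod_of_cofinal` (Milne's (b) from the layer identities on a
  cofinal family of layers), applied to `(↥V̄_L, Res_{V̄_L} C̄_S, invAt C̄_S inv_S V̄_L)` and the cofinal family of S-trace layers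
  `relTraceS S V̄_L` (bsd-line-x1-p1-w5, `isCompatibleFamily_relLayerInvS`);
* `U = V̄_L` for a layer `L ⊆ K_S` (`exists_layerSubgroupS_eq`, the glue file) — ON THE NOSE, so no transport is needed;
* `Ext¹_{C_{V̄_L}}(ℤ, Res C̄_S) = 0` and the value of `invAt C̄_S inv_S V̄_L` on the classes inflated from the relative layers
  (bsd-line-x1-p1-w5's `ext_one_eq_zero_resD_classBarSD`, `invAt_classBarSD_inflG` — the latter is VERBATIM the hypothesis `hinv`
  of the injectivity / surjectivity files);
* the arithmetic: `Hinj` = `exists_nsmul_eq_of_forall_layer_value_eq_zero_S` (`IdeleClassBarSModAlphaOneInjective`: global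
  reciprocity with restricted ramification, `C_S(L) ∩ ⋂ ker = C_S(L)^m`) and `Hsurj` = `exists_hom_forall_layer_value_eq_S`
  (`IdeleClassBarSModAlphaOneSurjective`: biduality / the existence theorem with restricted ramification).

* `adjointInjective_one_zmod_classBarSD_layerSubgroupS`, `adjointSurjective_one_zmod_classBarSD_layerSubgroupS` (at `U = V̄_L`);
* **`adjointBijective_one_zmod_classBarSD (U) (hm : 0 < m)`** — Milne's (b) for `(G_S, C̄_S, inv_S)` at every open normal `U`;
* **`adjointBijective_one_zmod_pow_classBarSD (hp : 0 < p) (U) (a) (ha)`** — verbatim the field `adjointBijective_one_zmod_pow`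
  of `TateDualityHypothesesAt p (classBarSD K S) (invS S)` (`m = p ^ a`; the primality of `p` and `S ⊇ S_p` play no role here).

HONEST FRAMING: this is the class field theory of the `S`-idèle class formation in the tree's `Ext`-language (Milne ADT I
Thm. 1.8 (b) = Harari Prop. 15.42 (a) at every finite layer inside `K_S`), assembled from the cell's typed arithmetic; it is
ONE field of the engine's hypotheses record — no Tate duality theorem for `G_S`, no case of Poitou–Tate and no case of BSD is
proved here; 0 cells / labels / tiers move.  Seat bsd-line-x1-p1-w8 g13.

## References
* J. S. Milne, *Arithmetic Duality Theorems* (2nd ed. 2006), I §1 Lemma 1.7, Theorem 1.8 (b); I §4. [MilneADT2006]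
* D. Harari, *Galois Cohomology and Class Field Theory*, Universitext (2020), Prop. 15.42 (a), §17.1 Theorem 17.2. [Harari2020]
* J. W. S. Cassels, A. Fröhlich (eds.), *Algebraic Number Theory* (1967), Ch. VII (J. Tate) §5.1, §11.3. [CasselsFrohlichANT1967]
* J.-P. Serre, *Galois Cohomology* (1997), I §2.2 Proposition 8. [SerreGaloisCohomology1997]
-/

noncomputable section

open NumberField IsDedekindDomain CategoryTheory CategoryTheory.Limits groupCohomology
open Field (absoluteGaloisGroup)
open Literature.NumberTheory.Automorphic Literature.NumberTheory.Automorphic.IdeleClassGroup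
open Literature.NumberTheory.NumberFields
open Literature.Algebra.Homology Literature.Algebra.Homology.DiscreteRep
open Literature.NumberTheory.GaloisRepresentations.LocalWeilDatum (galFixing)
open scoped Classical

namespace Literature.NumberTheory.GaloisRepresentations

namespace IdeleClassBar

variable {K : Type} [Field K] [NumberField K] (S : Finset (HeightOneSpectrum (𝓞 K)))

/-! ## §1. At a layer subgroup `U = V̄_L` -/

/-- **`α¹(V̄_L, ℤ/m)` is injective** for the `S`-idèle class formation at the layer subgroup `V̄_L = Gal(K_S/L)` of a layer
`L ⊆ K_S` and every `m ≥ 1`: door-c4 g16's criterion `adjointInjective_triv_zmod_of_cofinal` over the S-trace layers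
`V̄_E ∩ V̄_L` (`E ⊇ L` inside `K_S`), with `Ext¹_{C_{V̄_L}}(ℤ, Res C̄_S) = 0` (bsd-line-x1-p1-w5 `ext_one_eq_zero_resD_classBarSD`),
the value of `invAt C̄_S inv_S V̄_L` on inflated relative classes (`invAt_classBarSD_inflG`) and the arithmetic input
`exists_nsmul_eq_of_forall_layer_value_eq_zero_S`. [cite: MilneADT2006, I Theorem 1.8 (b)][cite: Harari2020, §17.1 Theorem 17.2]
[cite: CasselsFrohlichANT1967, Ch. VII §11.3] -/
theorem adjointInjective_one_zmod_classBarSD_layerSubgroupS (L : GalLayer K) (hL : ramificationSubgroup K (↑S : Set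
    (HeightOneSpectrum (𝓞 K))) ≤ galFixing K L.1) {m : ℕ}
    (hm : 0 < m) :
    ExtDuality.AdjointInjective (DiscreteRep.invAt (classBarSD K S) (invS S) (layerSubgroupS S L)) (triv (k := ℤ)
        (Γ := (layerSubgroupS S L : Subgroup (GaloisGroupUnramifiedOutside K (↑S : Set (HeightOneSpectrum (𝓞 K))))))
        (ZMod m))
      (show 1 + 1 = 2 from rfl) := by
  haveI := totallyDisconnectedSpace_GS S
  exact adjointInjective_triv_zmod_of_cofinal ((resD ℤ (layerSubgroupS S L : Subgroup (GaloisGroupUnramifiedOutside K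
      (↑S : Set (HeightOneSpectrum (𝓞 K)))))).obj (classBarSD K S)) (DiscreteRep.invAt (classBarSD K S) (invS S)
      (layerSubgroupS S L)) hm
    (fun x => ext_one_eq_zero_resD_classBarSD S (layerSubgroupS S L : Subgroup (GaloisGroupUnramifiedOutside K
        (↑S : Set (HeightOneSpectrum (𝓞 K))))) (LayerColimit.coe_isOpen _) x) (relTraceS S
        (layerSubgroupS S L : Subgroup (GaloisGroupUnramifiedOutside K (↑S : Set (HeightOneSpectrum (𝓞 K))))))
    fun φ hφ => exists_nsmul_eq_of_forall_layer_value_eq_zero_S S hL hm _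
      (fun E hE hSE h x => invAt_classBarSD_inflG S (layerSubgroupS S L) hE (layerSubgroupS_anti S h) x) φ
      fun E hE h χ => hφ ⟨⟨E, hE⟩, layerSubgroupS_anti S h⟩ χ

/-- **`α¹(V̄_L, ℤ/m)` is surjective** for the `S`-idèle class formation at `V̄_L` (`L ⊆ K_S`) and every `m ≥ 1`: door-c4 g16's
criterion `adjointSurjective_triv_zmod_of_cofinal` over the COFINAL family of S-trace layers (bsd-line-x1-p1-w5
`isCompatibleFamily_relLayerInvS`), with `Ext¹_{C_{V̄_L}}(ℤ, Res C̄_S) = 0`, `invAt_classBarSD_inflG` and the arithmetic input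
`exists_hom_forall_layer_value_eq_S` (a relative layer `E` with `V̄_E ≤ V̄_L` has `L ≤ E`, `le_of_layerSubgroupS_le`).
[cite: MilneADT2006, I Theorem 1.8 (b)][cite: Harari2020, Prop. 15.42 (a), §17.1 Theorem 17.2]
[cite: CasselsFrohlichANT1967, Ch. VII §11.3, §5.1] -/
theorem adjointSurjective_one_zmod_classBarSD_layerSubgroupS (L : GalLayer K) (hL : ramificationSubgroup K (↑S : Set
    (HeightOneSpectrum (𝓞 K))) ≤ galFixing K L.1) {m : ℕ}
    (hm : 0 < m) :
    ExtDuality.AdjointSurjective (DiscreteRep.invAt (classBarSD K S) (invS S) (layerSubgroupS S L)) (triv (k := ℤ)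
        (Γ := (layerSubgroupS S L : Subgroup (GaloisGroupUnramifiedOutside K (↑S : Set (HeightOneSpectrum (𝓞 K))))))
        (ZMod m))
      (show 1 + 1 = 2 from rfl) := by
  haveI := totallyDisconnectedSpace_GS S
  haveI : CompactSpace (layerSubgroupS S L : Subgroup (GaloisGroupUnramifiedOutside K (↑S : Set (HeightOneSpectrum
      (𝓞 K))))) := LayerColimit.compactSpace_subgroup_of_isOpen _ (LayerColimit.coe_isOpen _)
  exact adjointSurjective_triv_zmod_of_cofinal ((resD ℤ (layerSubgroupS S L : Subgroup (GaloisGroupUnramifiedOutside K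
      (↑S : Set (HeightOneSpectrum (𝓞 K)))))).obj (classBarSD K S)) (DiscreteRep.invAt (classBarSD K S) (invS S)
      (layerSubgroupS S L)) hm
    (fun x => ext_one_eq_zero_resD_classBarSD S (layerSubgroupS S L : Subgroup (GaloisGroupUnramifiedOutside K
        (↑S : Set (HeightOneSpectrum (𝓞 K))))) (LayerColimit.coe_isOpen _) x) (relTraceS S
        (layerSubgroupS S L : Subgroup (GaloisGroupUnramifiedOutside K (↑S : Set (HeightOneSpectrum (𝓞 K))))))
    (isCompatibleFamily_relLayerInvS S (layerSubgroupS S L : Subgroup (GaloisGroupUnramifiedOutside K (↑S : Set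
        (HeightOneSpectrum (𝓞 K))))) (LayerColimit.coe_isOpen _)).cofinal
    fun Ψ => (exists_hom_forall_layer_value_eq_S S hL hm _
      (fun E hE hSE h x => invAt_classBarSD_inflG S (layerSubgroupS S L) hE (layerSubgroupS_anti S h) x) Ψ).imp
      fun φ hφ => fun E χ => hφ E.1.1 E.1.2 (le_of_layerSubgroupS_le S hL E.2) χ

/-! ## §2. Milne's (b) for `(G_S, C̄_S, inv_S)` -/

/-- **MILNE'S HYPOTHESIS (b) FOR THE `S`-IDÈLE CLASS FORMATION**: for every number field `K`, finite set `S` of finite places,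
open normal `U ≤ G_S` and `m ≥ 1`, the map `α¹(U, ℤ/m) : Ext¹_{C_U}(ℤ/m, Res_U C̄_S) → Hom(Ext¹_{C_U}(ℤ, ℤ/m), ℚ/ℤ)` induced by
the Yoneda pairing and `invAt C̄_S inv_S U = inv_S ∘ cores_U` is BIJECTIVE (`U = V̄_L` for the layer `L = K̄^{Ũ}` inside `K_S`,
`exists_layerSubgroupS_eq`; §1).  Classical: the reciprocity isomorphism `C_S(L)/(C_S(L)^m · divisible) ≅ Gal(K_S/L)^{ab}/m` of
the `S`-idèle class formation at the finite layer `L` (Harari Prop. 15.42 (a)), in Milne's `Ext`-form.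
[cite: MilneADT2006, I Theorem 1.8 (b), §4][cite: Harari2020, Prop. 15.42 (a), §17.1 Theorem 17.2]
[cite: CasselsFrohlichANT1967, Ch. VII §11.3, §5.1 Main Theorem (B), (D)] -/
theorem adjointBijective_one_zmod_classBarSD (U : OpenNormalSubgroup (GaloisGroupUnramifiedOutside K (↑S : Set
    (HeightOneSpectrum (𝓞 K))))) {m : ℕ} (hm : 0 < m) :
    ExtDuality.AdjointBijective (DiscreteRep.invAt (classBarSD K S) (invS S) U)
      (triv (k := ℤ) (Γ := (U : Subgroup (GaloisGroupUnramifiedOutside K (↑S : Set (HeightOneSpectrum (𝓞 K))))))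
          (ZMod m)) (show 1 + 1 = 2 from rfl) := by
  obtain ⟨L, hL, rfl⟩ := exists_layerSubgroupS_eq S U
  exact ⟨adjointInjective_one_zmod_classBarSD_layerSubgroupS S L hL hm,
    adjointSurjective_one_zmod_classBarSD_layerSubgroupS S L hL hm⟩

/-- **The field `adjointBijective_one_zmod_pow` of `DiscreteRep.TateDualityHypothesesAt p (classBarSD K S) (invS S)`**,
verbatim: `α¹(U, ℤ/p^a)` is bijective for every open normal `U ≤ G_S` and every `a ≥ 1` (any `p ≥ 1`; the brick's other
fields — `invAt_injective`, `exists_invAt_eq`, `ext_one_eq_zero`, `ext_triv_divisible` — are bsd-line-x1-p1-w5's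
`tateDualityHypothesesAt_classBarSD_fields`). [cite: MilneADT2006, I Theorem 1.8 (b)][cite: Harari2020, §17.1 Theorem 17.2] -/
theorem adjointBijective_one_zmod_pow_classBarSD {p : ℕ} (hp : 0 < p) :
    ∀ (U : OpenNormalSubgroup (GaloisGroupUnramifiedOutside K (↑S : Set (HeightOneSpectrum (𝓞 K))))) (a : ℕ), 0 < a →
      ExtDuality.AdjointBijective (DiscreteRep.invAt (classBarSD K S) (invS S) U)
        (triv (k := ℤ) (Γ := (U : Subgroup (GaloisGroupUnramifiedOutside K (↑S : Set (HeightOneSpectrum (𝓞 K))))))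
            (ZMod (p ^ a))) (show 1 + 1 = 2 from rfl) :=
  fun U _ _ => adjointBijective_one_zmod_classBarSD S U (Nat.pow_pos hp)

end IdeleClassBar

end Literature.NumberTheory.GaloisRepresentations

end
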